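import Summits.AtomisticToContinuum.HydrodynamicLimit.Theorems.CollisionIsometryCLTDiffuseBackwardInfluenceStubStickLD
import HarnessLib

/-!
# The tube non-crossing large deviation of line `ballistic-tubes` is a THEOREM
(crux `DiffuseBackwardInfluence`, stmt-AtomisticToContinuum-12950; lead prover of line `share-nondegeneracy-one-flight`,
continuation c2; `--supports` file for the registered sub-goal `ballisticTubes_stub_tubeNonCrossingLD`)

`Cruxes/DiffuseBackwardInfluence/Lines/ballistic-tubes.lean` has the load-bearing stub `stub_tubeNonCrossingLD`: for `σ` below
some `σ₀`, the homogeneous Gibbs probability (`localGibbsLaw σ 1 0 1`) that the straight tubes of a prescribed `η`-fraction of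
the particles stay pairwise `ε_N`-separated during `[0, τ_N]`, `τ_N (N+1)^{1/3} → ∞`, is `≤ e^{-c(N+1)}` for every `c`,
eventually. This is `FewIdle.TubeLD σ 1` (`eqLaw σ 1 = localGibbsLaw σ 1 0 1` by `rfl`), hence a corollary — with `σ₀ = 1/2` —
of the share line's landed chain `stub_stickLD` (7/3 crossing-energy law + containers) ∘ `tubeLD_of_stickLD` (free-volume
domination). So the tube input is closed for BOTH lines of the crux that use it.
-/

namespace Summit.AtomisticToContinuum.HydrodynamicLimit.Theorems.DiffuseBackwardInfluenceShare

open scoped Topology ENNReal Classical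
open Filter Set MeasureTheory

noncomputable section

/-- **Line `ballistic-tubes`, stub 3 (`stub_tubeNonCrossingLD`), PROVED** with `σ₀ = 1/2`: the static tube
non-crossing large deviation under the homogeneous hard-sphere Gibbs law at temperature `1`, verbatim the skeleton's
statement (registered on the crux item as `ballisticTubes_stub_tubeNonCrossingLD`). [folklore] -/
theorem ballisticTubes_stub_tubeNonCrossingLD : ∃ σ₀ : ℝ, 0 < σ₀ ∧ ∀ σ : ℝ, 0 < σ → σ < σ₀ → (∀ τ : ℕ → ℝ, (∀ N, 0 < τ N) → Tendsto (fun N : ℕ => τ N * ((N + 1 : ℕ) : ℝ) ^ ((1 : ℝ) / 3)) atTop atTop → ∀ η : ℝ, 0 < η → ∀ c : ℝ, ∀ᶠ N : ℕ in atTop, ∀ (Φ : Literature.Analysis.FluidPDE.HardSphereFlow (Literature.Analysis.FluidPDE.Torus.geometry (Fin 3)) (Literature.MathematicalPhysics.KineticTheory.hsDiameter σ N) (N + 1)) (S : Finset (Fin (N + 1))), η * ((N + 1 : ℕ) : ℝ) ≤ (S.card : ℝ) → Literature.MathematicalPhysics.KineticTheory.localGibbsLaw σ (fun _ => 1) (fun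 _ => 0) (fun _ => 1) N Φ {z : Literature.Analysis.FluidPDE.Config (N + 1) (Fin 3) (UnitAddTorus (Fin 3)) | ∀ i ∈ S, ∀ j ∈ S, i ≠ j → ∀ r ∈ Set.Icc (0 : ℝ) (τ N), Literature.MathematicalPhysics.KineticTheory.hsDiameter σ N ≤ ‖(Literature.Analysis.FluidPDE.Torus.geometry (Fin 3)).sepVec (Literature.Analysis.FluidPDE.freeFlight (Literature.Analysis.FluidPDE.Torus.geometry (Fin 3)) r z i).1 (Literature.Analysis.FluidPDE.freeFlight (Literature.Analysis.FluidPDE.Torus.geometry (Fin 3)) r z j).1‖} ≤ ENNReal.ofReal (Real.exp (-(c * ((N + 1 : ℕ) : ℝ))))) :=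
  ⟨1 / 2, by norm_num, fun σ hσ hσ2 =>
    tubeLD_of_stickLD σ 1 hσ hσ2 one_pos (stub_stickLD σ 1 hσ hσ2 one_pos)⟩

end

end Summit.AtomisticToContinuum.HydrodynamicLimit.Theorems.DiffuseBackwardInfluenceShare
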